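import Mathlib
import Summits.NavierStokesRegularity.NavierStokesRegularity.Theorems.EulerZoomLiouvillePowerGaugeEulerLiouvilleIrrotationalTools
import Summits.NavierStokesRegularity.NavierStokesRegularity.Theorems.EulerZoomLiouvillePowerGaugeEulerLiouvilleGalileanHarmonicShear
import Summits.NavierStokesRegularity.NavierStokesRegularity.Theorems.EulerZoomLiouvillePowerGaugeEulerLiouvilleKillingRotation
import Summits.NavierStokesRegularity.NavierStokesRegularity.Theorems.CoriolisHeadTypeIRateTransport
import Literature.Analysis.FluidPDE.TypeIAncientMildRssPullback
import Literature.Analysis.FluidPDE.DivCurlAnnihilator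
import Literature.Analysis.FluidPDE.WeakGradientIBP
import Literature.Analysis.FluidPDE.SolenoidalTruncation
import HarnessLib

/-!
# Crux E `PowerGaugeEulerLiouville` (stmt-NavierStokesRegularity-19832): KILLING SHEAR VANISHES UNDER THE A-GAUGE (width seat ns-ezl-w3 g5)

Rotational twin of `GalileanFrames.harmonicShearVanishes` (ns-ezl-w3 g4).  `U ∈ L¹_loc(ℝ³;ℝ³)` weakly divergence-free with slice growth
`∫⁻_{B_R}‖U‖² ≤ C R^{1−2ρ}` (`R ≥ 1`, `ρ > 0`), `B` skew (`⟪Bx, x⟫ = 0`), and the Lie derivative `L_B U = DU(B·) − BU` WEAKLY A GRADIENT —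
`∫ ⟪U, DΦ(z)(Bz) − BΦ(z)⟫ = 0` for every smooth compactly supported trace-free `Φ` — give `R_{−θ} U(R_θ ·) = U` a.e. for every `θ`, `R_t = exp(tB)`
(`Killing.killingShearVanishes`; analytic core of the «tumbling members» stratum: the tested identity at two times makes `L_{A(τ₁)−A(τ₂)} V` weakly a
gradient).  ROUTE (tree tools only): `D := R_{−θ}U(R_θ ·) − U` is locally integrable and weakly divergence-free (`Killing.gradient_comp_expSkew`) and
annihilates every curl pair `Ξ` — `t ↦ ∫⟪U, R_tΞ(R_{−t}·)⟫` has derivative `−∫⟪U, DΞ_t(B·) − BΞ_t⟫ = 0` (`Killing.integral_inner_rotate_eq_of_shear`;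
`Ξ_t` is trace-free as its differential is a conjugate of `DΞ`, `Killing.trace_rotate_conj`) — so each component of `D` is weakly harmonic
(`integral_laplacian_mul_inner_eq_zero_of_curlPair`) with growth exponent `1 − 2ρ < 3` (`Killing.setLIntegral_ball_comp_expSkew`), hence `D = 0` a.e.
(`ae_eq_zero_of_weaklyHarmonic_of_growth`).  WHAT THIS IS NOT: not NS regularity, not the crux E — a stratum tool of the crux CLASS 19832 (MODEL
lattice; E/NS strata), `--supports` stmt-19832; 19832 OPEN. [cite: LemarieRieusset2016, proof of Thm 4.4 pp. 56–57; GilbargTrudinger2001, Thm 2.1]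
-/

noncomputable section

-- flat `Theorems/<Route><Decl>…` files of one crux share the namespace of the crux (tree convention: `Summit.<S>.<S>.…`)
set_option linter.dupNamespace false

open MeasureTheory Set Filter Topology Metric Function TopologicalSpace InnerProductSpace
open scoped ENNReal NNReal RealInnerProductSpace Laplacian ContDiff

namespace Summit.NavierStokesRegularity.NavierStokesRegularity.Theorems.PowerGaugeEulerLiouville

namespace Killing

open Literature.Analysis Literature.Analysis.FunctionSpaces Literature.Analysis.FluidPDE
open Summit.NavierStokesRegularity.NavierStokesRegularity.Theorems.CoriolisHead
open Summit.NavierStokesRegularity.NavierStokesRegularity.Theorems.PowerGaugeEulerLiouville.GalileanFrames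

variable {B : EuclideanSpace ℝ (Fin 3) →L[ℝ] EuclideanSpace ℝ (Fin 3)}

/-- Precomposition with a rotation preserves compact support. [folklore] -/
theorem hasCompactSupport_comp_expSkew (hB : ∀ x : EuclideanSpace ℝ (Fin 3), ⟪B x, x⟫ = 0) (s : ℝ)
    {β : Type*} [Zero β] {f : EuclideanSpace ℝ (Fin 3) → β} (hf : HasCompactSupport f) :
    HasCompactSupport (fun w => f (NormedSpace.exp (s • B) w)) := by
  obtain ⟨L, -, hL⟩ := rss_exists_rot hB s
  have he : (fun w => f (NormedSpace.exp (s • B) w)) = f ∘ L.symm.toHomeomorph := by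
    funext z; simp only [Function.comp_apply]; rw [← hL z]; rfl
  rw [he]
  exact hf.comp_homeomorph _

/-- The differential of the rotated field `Ξ_t = R_t Ξ(R_{−t}·)` is the conjugate `R_t ∘ DΞ(R_{−t}w) ∘ R_{−t}`. [folklore] -/
theorem hasFDerivAt_rotate (B : EuclideanSpace ℝ (Fin 3) →L[ℝ] EuclideanSpace ℝ (Fin 3)) (t : ℝ)
    {Ξ : EuclideanSpace ℝ (Fin 3) → EuclideanSpace ℝ (Fin 3)} (hΞ : Differentiable ℝ Ξ) (w : EuclideanSpace ℝ (Fin 3)) :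
    HasFDerivAt (fun w => NormedSpace.exp (t • B) (Ξ (NormedSpace.exp ((-t) • B) w)))
      ((NormedSpace.exp (t • B)).comp ((fderiv ℝ Ξ (NormedSpace.exp ((-t) • B) w)).comp (NormedSpace.exp ((-t) • B)))) w :=
  (NormedSpace.exp (t • B)).hasFDerivAt.comp w
    (((hΞ _).hasFDerivAt).comp w (NormedSpace.exp ((-t) • B)).hasFDerivAt)

/-- Conjugating by a rotation does not change the trace: `tr (R_t M R_{−t}) = tr M`. [folklore] -/
theorem trace_rotate_conj (B : EuclideanSpace ℝ (Fin 3) →L[ℝ] EuclideanSpace ℝ (Fin 3)) (t : ℝ)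
    (M : EuclideanSpace ℝ (Fin 3) →L[ℝ] EuclideanSpace ℝ (Fin 3)) :
    LinearMap.trace ℝ (EuclideanSpace ℝ (Fin 3))
        (((NormedSpace.exp (t • B)).comp (M.comp (NormedSpace.exp ((-t) • B))) :
          EuclideanSpace ℝ (Fin 3) →L[ℝ] EuclideanSpace ℝ (Fin 3)) : EuclideanSpace ℝ (Fin 3) →ₗ[ℝ] EuclideanSpace ℝ (Fin 3)) =
      LinearMap.trace ℝ (EuclideanSpace ℝ (Fin 3)) (M : EuclideanSpace ℝ (Fin 3) →ₗ[ℝ] EuclideanSpace ℝ (Fin 3)) := by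
  have hinv : ((NormedSpace.exp ((-t) • B) : EuclideanSpace ℝ (Fin 3) →L[ℝ] EuclideanSpace ℝ (Fin 3)) :
        EuclideanSpace ℝ (Fin 3) →ₗ[ℝ] EuclideanSpace ℝ (Fin 3)) ∘ₗ
      ((NormedSpace.exp (t • B) : EuclideanSpace ℝ (Fin 3) →L[ℝ] EuclideanSpace ℝ (Fin 3)) :
        EuclideanSpace ℝ (Fin 3) →ₗ[ℝ] EuclideanSpace ℝ (Fin 3)) = LinearMap.id := by
    apply LinearMap.ext
    intro v
    simp only [LinearMap.comp_apply, ContinuousLinearMap.coe_coe, LinearMap.id_apply]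
    exact expSkew_neg_apply_expSkew B t v
  rw [show (((NormedSpace.exp (t • B)).comp (M.comp (NormedSpace.exp ((-t) • B))) :
          EuclideanSpace ℝ (Fin 3) →L[ℝ] EuclideanSpace ℝ (Fin 3)) : EuclideanSpace ℝ (Fin 3) →ₗ[ℝ] EuclideanSpace ℝ (Fin 3)) =
        ((NormedSpace.exp (t • B) : EuclideanSpace ℝ (Fin 3) →L[ℝ] EuclideanSpace ℝ (Fin 3)) :
            EuclideanSpace ℝ (Fin 3) →ₗ[ℝ] EuclideanSpace ℝ (Fin 3)) ∘ₗ
          (((M : EuclideanSpace ℝ (Fin 3) →ₗ[ℝ] EuclideanSpace ℝ (Fin 3))) ∘ₗ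
            ((NormedSpace.exp ((-t) • B) : EuclideanSpace ℝ (Fin 3) →L[ℝ] EuclideanSpace ℝ (Fin 3)) :
              EuclideanSpace ℝ (Fin 3) →ₗ[ℝ] EuclideanSpace ℝ (Fin 3))) from rfl,
    LinearMap.trace_comp_comm', LinearMap.comp_assoc, hinv, LinearMap.comp_id]

/-- The gradient of a rotated scalar is the rotated gradient: `∇(φ ∘ R_{−θ})(w) = R_θ ∇φ(R_{−θ} w)`. [folklore] -/
theorem gradient_comp_expSkew (hB : ∀ x : EuclideanSpace ℝ (Fin 3), ⟪B x, x⟫ = 0) (θ : ℝ)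
    {φ : EuclideanSpace ℝ (Fin 3) → ℝ} (hφ : Differentiable ℝ φ) (w : EuclideanSpace ℝ (Fin 3)) :
    gradient (fun x => φ (NormedSpace.exp ((-θ) • B) x)) w =
      NormedSpace.exp (θ • B) (gradient φ (NormedSpace.exp ((-θ) • B) w)) := by
  have hd : HasFDerivAt (fun x => φ (NormedSpace.exp ((-θ) • B) x))
      ((fderiv ℝ φ (NormedSpace.exp ((-θ) • B) w)).comp (NormedSpace.exp ((-θ) • B))) w :=
    ((hφ _).hasFDerivAt).comp w (NormedSpace.exp ((-θ) • B)).hasFDerivAt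
  apply ext_inner_right ℝ
  intro v
  rw [gradient, hd.fderiv, InnerProductSpace.toDual_symm_apply, inner_expSkew_left hB, gradient,
    InnerProductSpace.toDual_symm_apply]
  rfl

/-- **Pairings with rotates are constant when the Killing shear is weakly orthogonal.**  `U ∈ L¹_loc(ℝ³; ℝ³)`, `Ξ` a test field, `B` skew,
and for every `t` the rotated field `Ξ_t = R_tΞ(R_{−t}·)` satisfies `∫ ⟪U, DΞ_t(B·) − BΞ_t⟫ = 0` (written with `DΞ_t(w)(Bw) = R_t DΞ(R_{−t}w)(B R_{−t} w)`).
Then `∫ ⟪U, R_sΞ(R_{−s}·)⟫ = ∫ ⟪U, Ξ⟫` for every `s` (the pairing has derivative `−∫⟪U, DΞ_t(B·) − BΞ_t⟫ = 0`, dominated differentiation).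
[folklore] -/
theorem integral_inner_rotate_eq_of_shear (hB : ∀ x : EuclideanSpace ℝ (Fin 3), ⟪B x, x⟫ = 0)
    {U Ξ : EuclideanSpace ℝ (Fin 3) → EuclideanSpace ℝ (Fin 3)}
    (hU : LocallyIntegrable U volume) (hΞ : IsTestFunctionOn (⊤ : Opens (EuclideanSpace ℝ (Fin 3))) Ξ)
    (horth : ∀ t : ℝ, ∫ w, ⟪U w, NormedSpace.exp (t • B) (fderiv ℝ Ξ (NormedSpace.exp ((-t) • B) w) (B (NormedSpace.exp ((-t) • B) w))) -
      B (NormedSpace.exp (t • B) (Ξ (NormedSpace.exp ((-t) • B) w)))⟫ = 0) (s : ℝ) :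
    ∫ w, ⟪U w, NormedSpace.exp (s • B) (Ξ (NormedSpace.exp ((-s) • B) w))⟫ = ∫ w, ⟪U w, Ξ w⟫ := by
  have hΞc : Continuous Ξ := hΞ.contDiff.continuous
  have hΞd : Differentiable ℝ Ξ := hΞ.contDiff.differentiable (by simp)
  have hDΞc : Continuous (fderiv ℝ Ξ) := hΞ.contDiff.continuous_fderiv (by simp)
  have hDΞs : HasCompactSupport (fderiv ℝ Ξ) := hΞ.hasCompactSupport.fderiv (𝕜 := ℝ)
  obtain ⟨M₀, hM₀⟩ := hΞc.bounded_above_of_compact_support hΞ.hasCompactSupport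
  obtain ⟨M₁, hM₁⟩ := hDΞc.bounded_above_of_compact_support hDΞs
  have hM₀0 : 0 ≤ M₀ := (norm_nonneg _).trans (hM₀ 0)
  have hM₁0 : 0 ≤ M₁ := (norm_nonneg _).trans (hM₁ 0)
  obtain ⟨R₀, hR₀0, hR₀⟩ := (hΞ.hasCompactSupport.isCompact.isBounded).subset_closedBall_lt 0 (0 : EuclideanSpace ℝ (Fin 3))
  have hnorm : ∀ (t : ℝ) (v : EuclideanSpace ℝ (Fin 3)), ‖NormedSpace.exp (t • B) v‖ = ‖v‖ := fun t v =>
    TypeIRate.norm_exp_smul_skew hB t v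
  have hRc : ∀ t : ℝ, Continuous fun w : EuclideanSpace ℝ (Fin 3) => NormedSpace.exp (t • B) w := fun t =>
    (NormedSpace.exp (t • B)).continuous
  have hoff : ∀ (t : ℝ) (w : EuclideanSpace ℝ (Fin 3)), w ∉ closedBall (0 : EuclideanSpace ℝ (Fin 3)) R₀ →
      Ξ (NormedSpace.exp ((-t) • B) w) = 0 ∧ fderiv ℝ Ξ (NormedSpace.exp ((-t) • B) w) = 0 := by
    intro t w hw
    have hzt : NormedSpace.exp ((-t) • B) w ∉ tsupport Ξ := by
      intro hmem
      have h1 : ‖NormedSpace.exp ((-t) • B) w‖ ≤ R₀ := mem_closedBall_zero_iff.1 (hR₀ hmem)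
      rw [hnorm] at h1
      exact hw (mem_closedBall_zero_iff.2 h1)
    refine ⟨image_eq_zero_of_notMem_tsupport hzt, ?_⟩
    by_contra hne
    exact hzt (support_fderiv_subset ℝ (mem_support.2 hne))
  set I : ℝ → ℝ := fun t => ∫ w, ⟪U w, NormedSpace.exp (t • B) (Ξ (NormedSpace.exp ((-t) • B) w))⟫ with hI
  set F' : ℝ → EuclideanSpace ℝ (Fin 3) → ℝ := fun t w =>
    ⟪U w, B (NormedSpace.exp (t • B) (Ξ (NormedSpace.exp ((-t) • B) w))) +
      NormedSpace.exp (t • B) (fderiv ℝ Ξ (NormedSpace.exp ((-t) • B) w) (-(B (NormedSpace.exp ((-t) • B) w))))⟫ with hF'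
  have hderiv : ∀ t₀ : ℝ, HasDerivAt I 0 t₀ := by
    intro t₀
    set K : Set (EuclideanSpace ℝ (Fin 3)) := closedBall 0 R₀ with hK
    have hKc : IsCompact K := isCompact_closedBall _ _
    set bound : EuclideanSpace ℝ (Fin 3) → ℝ := K.indicator fun w => ‖B‖ * (M₀ + M₁ * R₀) * ‖U w‖ with hbound
    have hbound_int : Integrable bound volume := by
      rw [hbound, integrable_indicator_iff hKc.measurableSet]
      exact ((hU.integrableOn_isCompact hKc).norm.const_mul (‖B‖ * (M₀ + M₁ * R₀)))
    have hcontF : ∀ t : ℝ, Continuous fun w => NormedSpace.exp (t • B) (Ξ (NormedSpace.exp ((-t) • B) w)) := fun t =>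
      (hRc t).comp (hΞc.comp (hRc (-t)))
    have hF_meas : ∀ t : ℝ, AEStronglyMeasurable
        (fun w => ⟪U w, NormedSpace.exp (t • B) (Ξ (NormedSpace.exp ((-t) • B) w))⟫) volume := fun t =>
      hU.aestronglyMeasurable.inner (hcontF t).aestronglyMeasurable
    have hF_int : Integrable (fun w => ⟪U w, NormedSpace.exp (t₀ • B) (Ξ (NormedSpace.exp ((-t₀) • B) w))⟫) volume := by
      refine integrable_inner_of_locallyIntegrable_of_hasCompactSupport hU (hcontF t₀) ?_
      exact (hasCompactSupport_comp_expSkew hB (-t₀) hΞ.hasCompactSupport).comp_left (map_zero _)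
    have hF'_meas : AEStronglyMeasurable (F' t₀) volume := by
      refine hU.aestronglyMeasurable.inner (Continuous.aestronglyMeasurable ?_)
      exact (B.continuous.comp (hcontF t₀)).add
        ((hRc t₀).comp (((hDΞc.comp (hRc (-t₀))).clm_apply ((B.continuous.comp (hRc (-t₀))).neg))))
    have h_bound : ∀ᵐ w ∂(volume : Measure (EuclideanSpace ℝ (Fin 3))), ∀ t ∈ ball t₀ 1, ‖F' t w‖ ≤ bound w := by
      refine ae_of_all _ fun w t _ => ?_
      by_cases hw : w ∈ K
      · rw [hbound, indicator_of_mem hw, hF']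
        have hwR : ‖w‖ ≤ R₀ := mem_closedBall_zero_iff.1 hw
        calc ‖⟪U w, B (NormedSpace.exp (t • B) (Ξ (NormedSpace.exp ((-t) • B) w))) +
                NormedSpace.exp (t • B) (fderiv ℝ Ξ (NormedSpace.exp ((-t) • B) w) (-(B (NormedSpace.exp ((-t) • B) w))))⟫‖
            ≤ ‖U w‖ * ‖B (NormedSpace.exp (t • B) (Ξ (NormedSpace.exp ((-t) • B) w))) +
                NormedSpace.exp (t • B) (fderiv ℝ Ξ (NormedSpace.exp ((-t) • B) w) (-(B (NormedSpace.exp ((-t) • B) w))))‖ :=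
              norm_inner_le_norm _ _
          _ ≤ ‖U w‖ * (‖B‖ * M₀ + M₁ * (‖B‖ * R₀)) := by
              gcongr
              refine (norm_add_le _ _).trans (add_le_add ?_ ?_)
              · calc ‖B (NormedSpace.exp (t • B) (Ξ (NormedSpace.exp ((-t) • B) w)))‖
                    ≤ ‖B‖ * ‖NormedSpace.exp (t • B) (Ξ (NormedSpace.exp ((-t) • B) w))‖ := B.le_opNorm _
                  _ ≤ ‖B‖ * M₀ := by rw [hnorm]; exact mul_le_mul_of_nonneg_left (hM₀ _) (norm_nonneg _)
              · rw [hnorm]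
                calc ‖fderiv ℝ Ξ (NormedSpace.exp ((-t) • B) w) (-(B (NormedSpace.exp ((-t) • B) w)))‖
                    ≤ ‖fderiv ℝ Ξ (NormedSpace.exp ((-t) • B) w)‖ * ‖-(B (NormedSpace.exp ((-t) • B) w))‖ :=
                      ContinuousLinearMap.le_opNorm _ _
                  _ ≤ M₁ * (‖B‖ * R₀) := by
                      refine mul_le_mul (hM₁ _) ?_ (norm_nonneg _) hM₁0
                      rw [norm_neg]
                      calc ‖B (NormedSpace.exp ((-t) • B) w)‖ ≤ ‖B‖ * ‖NormedSpace.exp ((-t) • B) w‖ := B.le_opNorm _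
                        _ ≤ ‖B‖ * R₀ := by rw [hnorm]; exact mul_le_mul_of_nonneg_left hwR (norm_nonneg _)
          _ = ‖B‖ * (M₀ + M₁ * R₀) * ‖U w‖ := by ring
      · obtain ⟨h0, hD0⟩ := hoff t w hw
        rw [hbound, indicator_of_notMem hw]
        simp only [hF', h0, hD0, map_zero, zero_apply, add_zero, inner_zero_right, norm_zero, le_refl]
    have h_diff : ∀ᵐ w ∂(volume : Measure (EuclideanSpace ℝ (Fin 3))), ∀ t ∈ ball t₀ 1,
        HasDerivAt (fun t : ℝ => ⟪U w, NormedSpace.exp (t • B) (Ξ (NormedSpace.exp ((-t) • B) w))⟫) (F' t w) t := by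
      refine ae_of_all _ fun w t _ => ?_
      have h1 : HasDerivAt (fun s : ℝ => Ξ (NormedSpace.exp ((-s) • B) w))
          (fderiv ℝ Ξ (NormedSpace.exp ((-t) • B) w) (-(B (NormedSpace.exp ((-t) • B) w)))) t :=
        (hΞd _).hasFDerivAt.comp_hasDerivAt t (hasDerivAt_expSkew_neg_apply B w t)
      have h2 := (hasDerivAt_exp_smul_const' (𝕂 := ℝ) B t).clm_apply h1
      have h3 : HasDerivAt (fun s : ℝ => NormedSpace.exp (s • B) (Ξ (NormedSpace.exp ((-s) • B) w)))
          (B (NormedSpace.exp (t • B) (Ξ (NormedSpace.exp ((-t) • B) w))) +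
            NormedSpace.exp (t • B) (fderiv ℝ Ξ (NormedSpace.exp ((-t) • B) w) (-(B (NormedSpace.exp ((-t) • B) w))))) t :=
        h2.congr_deriv rfl
      have h := (hasDerivAt_const t (U w)).inner ℝ h3
      simpa [hF'] using h
    have hmain := hasDerivAt_integral_of_dominated_loc_of_deriv_le (ball_mem_nhds t₀ one_pos)
      (Eventually.of_forall hF_meas) hF_int hF'_meas h_bound hbound_int h_diff
    -- the derivative is `−∫⟪U, DΞ_t(B·) − BΞ_t⟫ = 0`
    have hval : ∫ w, F' t₀ w = 0 := by
      have e1 : (fun w => F' t₀ w) = fun w =>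
          -⟪U w, NormedSpace.exp (t₀ • B) (fderiv ℝ Ξ (NormedSpace.exp ((-t₀) • B) w) (B (NormedSpace.exp ((-t₀) • B) w))) -
            B (NormedSpace.exp (t₀ • B) (Ξ (NormedSpace.exp ((-t₀) • B) w)))⟫ := by
        funext w
        simp only [hF', map_neg]
        rw [← inner_neg_right]
        congr 1
        abel
      rw [e1, integral_neg, horth t₀, neg_zero]
    rw [hval] at hmain
    exact hmain.2
  have hdiffI : Differentiable ℝ I := fun t => (hderiv t).differentiableAt
  have hI0 : ∀ t, deriv I t = 0 := fun t => (hderiv t).deriv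
  have hconst := is_const_of_deriv_eq_zero hdiffI hI0 s 0
  simp only [hI, neg_zero, expSkew_zero_apply] at hconst
  exact hconst

/-- **KILLING SHEAR VANISHES UNDER THE A-GAUGE.**  A locally integrable field `U` on `ℝ³`, weakly divergence-free, with the slice growth
`∫⁻_{B_R}‖U‖² ≤ C R^{1−2ρ}` (`R ≥ 1`, `ρ > 0`), and a skew operator `B` (`⟪Bx, x⟫ = 0`) such that the Lie derivative `L_B U = DU(B·) − BU` is
weakly a gradient — `∫ ⟪U, DΦ(z)(Bz) − BΦ(z)⟫ = 0` for every smooth compactly supported trace-free `Φ` — is invariant under the rotations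
`R_θ = exp(θB)`: `R_{−θ} U(R_θ ·) = U` a.e. for every `θ`.  Rotational twin of `GalileanFrames.harmonicShearVanishes`.
[cite: LemarieRieusset2016, proof of Thm 4.4 pp. 56–57; GilbargTrudinger2001, Thm 2.1] -/
theorem killingShearVanishes :
    ∀ ρ : ℝ, 0 < ρ → ∀ (U : EuclideanSpace ℝ (Fin 3) → EuclideanSpace ℝ (Fin 3))
    (B : EuclideanSpace ℝ (Fin 3) →L[ℝ] EuclideanSpace ℝ (Fin 3)) (C : ℝ),
    (∀ x, ⟪B x, x⟫ = 0) →
    LocallyIntegrable U volume →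
    (∀ R : ℝ, 1 ≤ R → ∫⁻ z in Metric.ball (0 : EuclideanSpace ℝ (Fin 3)) R, ‖U z‖ₑ ^ 2 ≤ ENNReal.ofReal (C * R ^ (1 - 2 * ρ))) →
    (∀ φ : EuclideanSpace ℝ (Fin 3) → ℝ, ContDiff ℝ (⊤ : ℕ∞) φ → HasCompactSupport φ → ∫ z, ⟪U z, gradient φ z⟫ = 0) →
    (∀ Φ : EuclideanSpace ℝ (Fin 3) → EuclideanSpace ℝ (Fin 3), ContDiff ℝ (⊤ : ℕ∞) Φ → HasCompactSupport Φ →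
      (∀ z, LinearMap.trace ℝ (EuclideanSpace ℝ (Fin 3))
        ((fderiv ℝ Φ z : EuclideanSpace ℝ (Fin 3) →L[ℝ] EuclideanSpace ℝ (Fin 3)) :
          EuclideanSpace ℝ (Fin 3) →ₗ[ℝ] EuclideanSpace ℝ (Fin 3)) = 0) →
      ∫ z, ⟪U z, (fderiv ℝ Φ z) (B z) - B (Φ z)⟫ = 0) →
    ∀ θ : ℝ, (fun z => NormedSpace.exp ((-θ) • B) (U (NormedSpace.exp (θ • B) z))) =ᵐ[volume] U := by
  intro ρ hρ U B C hB hUl hgrow hdivU hshear θ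
  have hnorm : ∀ (t : ℝ) (v : EuclideanSpace ℝ (Fin 3)), ‖NormedSpace.exp (t • B) v‖ = ‖v‖ := fun t v =>
    TypeIRate.norm_exp_smul_skew hB t v
  have hRc : ∀ t : ℝ, Continuous fun w : EuclideanSpace ℝ (Fin 3) => NormedSpace.exp (t • B) w := fun t =>
    (NormedSpace.exp (t • B)).continuous
  -- the increment `D = R_{−θ} U(R_θ ·) − U`
  have hUrl : LocallyIntegrable (fun z => U (NormedSpace.exp (θ • B) z)) volume := locallyIntegrable_comp_expSkew hB θ hUl
  have hUsl : LocallyIntegrable (fun z => NormedSpace.exp ((-θ) • B) (U (NormedSpace.exp (θ • B) z))) volume := by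
    have h := (NormedSpace.exp ((-θ) • B)).locallyIntegrableOn_comp (locallyIntegrableOn_univ.2 hUrl)
    exact locallyIntegrableOn_univ.1 h
  set D : EuclideanSpace ℝ (Fin 3) → EuclideanSpace ℝ (Fin 3) := fun z =>
    NormedSpace.exp ((-θ) • B) (U (NormedSpace.exp (θ • B) z)) - U z with hD
  have hDl : LocallyIntegrable D volume := hUsl.sub hUl
  -- pairings of `D` with test fields split, the first term rotated back onto `U`
  have hsplit : ∀ Ξ : EuclideanSpace ℝ (Fin 3) → EuclideanSpace ℝ (Fin 3),
      IsTestFunctionOn (⊤ : Opens (EuclideanSpace ℝ (Fin 3))) Ξ →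
      ∫ z, ⟪D z, Ξ z⟫ = (∫ w, ⟪U w, NormedSpace.exp (θ • B) (Ξ (NormedSpace.exp ((-θ) • B) w))⟫) - ∫ z, ⟪U z, Ξ z⟫ := by
    intro Ξ hΞ
    have hΞc : Continuous Ξ := hΞ.contDiff.continuous
    have i1 : Integrable (fun z => ⟪NormedSpace.exp ((-θ) • B) (U (NormedSpace.exp (θ • B) z)), Ξ z⟫) volume :=
      integrable_inner_of_locallyIntegrable_of_hasCompactSupport hUsl hΞc hΞ.hasCompactSupport
    have i2 : Integrable (fun z => ⟪U z, Ξ z⟫) volume :=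
      integrable_inner_of_locallyIntegrable_of_hasCompactSupport hUl hΞc hΞ.hasCompactSupport
    have e1 : (fun z => ⟪D z, Ξ z⟫) = fun z => ⟪NormedSpace.exp ((-θ) • B) (U (NormedSpace.exp (θ • B) z)), Ξ z⟫ - ⟪U z, Ξ z⟫ := by
      funext z; rw [hD, inner_sub_left]
    -- `∫⟪R_{−θ} U(R_θ z), Ξ z⟫ dz = ∫ G(R_θ z) dz = ∫ G` with `G w = ⟪U w, R_θ Ξ(R_{−θ} w)⟫`
    have e3 : (∫ z, ⟪NormedSpace.exp ((-θ) • B) (U (NormedSpace.exp (θ • B) z)), Ξ z⟫) =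
        ∫ w, ⟪U w, NormedSpace.exp (θ • B) (Ξ (NormedSpace.exp ((-θ) • B) w))⟫ := by
      have h := integral_comp_expSkew hB θ (fun w => ⟪U w, NormedSpace.exp (θ • B) (Ξ (NormedSpace.exp ((-θ) • B) w))⟫)
      beta_reduce at h
      rw [← h]
      refine integral_congr_ae (ae_of_all _ fun z => ?_)
      simp only [inner_expSkew_left hB, neg_neg, expSkew_neg_apply_expSkew]
    rw [e1, integral_sub i1 i2, e3]
  -- (1) `D` is weakly divergence-free
  have hDdiv : IsWeaklyDivFree D := by
    intro φ hφ
    have hφd : Differentiable ℝ φ := hφ.contDiff.differentiable (by simp)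
    set ψ : EuclideanSpace ℝ (Fin 3) → ℝ := fun x => φ (NormedSpace.exp ((-θ) • B) x) with hψ
    have hψs : ContDiff ℝ (⊤ : ℕ∞) ψ := hφ.contDiff.comp (NormedSpace.exp ((-θ) • B)).contDiff
    have hψc : HasCompactSupport ψ := hasCompactSupport_comp_expSkew hB (-θ) hφ.hasCompactSupport
    -- the gradient field of `φ` is a test field, and its rotate is the gradient field of `ψ`
    have hG : IsTestFunctionOn (⊤ : Opens (EuclideanSpace ℝ (Fin 3))) (gradient φ) :=
      { contDiff := by
          refine contDiff_infty.2 fun n => ?_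
          exact (InnerProductSpace.toDual ℝ (EuclideanSpace ℝ (Fin 3))).symm.contDiff.comp
            (hφ.contDiff.fderiv_right (m := n) (by exact_mod_cast le_top))
        hasCompactSupport := (hφ.hasCompactSupport.fderiv (𝕜 := ℝ)).comp_left
          (g := (InnerProductSpace.toDual ℝ (EuclideanSpace ℝ (Fin 3))).symm) (map_zero _)
        tsupport_subset := by simp }
    have hgrad : ∀ w, NormedSpace.exp (θ • B) (gradient φ (NormedSpace.exp ((-θ) • B) w)) = gradient ψ w := by
      intro w; rw [hψ, gradient_comp_expSkew hB θ hφd]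
    rw [hsplit _ hG]
    simp_rw [hgrad]
    rw [hdivU ψ hψs hψc, hdivU φ hφ.contDiff hφ.hasCompactSupport, sub_zero]
  -- (2) `D` annihilates every curl pair
  have hDcurl : ∀ g : EuclideanSpace ℝ (Fin 3) → ℝ, IsTestFunctionOn (⊤ : Opens (EuclideanSpace ℝ (Fin 3))) g →
      ∀ a c : EuclideanSpace ℝ (Fin 3), ∫ x, ⟪D x, fderiv ℝ g x a • c - fderiv ℝ g x c • a⟫ = 0 := by
    intro g hg a c
    set Ξ : EuclideanSpace ℝ (Fin 3) → EuclideanSpace ℝ (Fin 3) := fun x => fderiv ℝ g x a • c - fderiv ℝ g x c • a with hΞ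
    have hΞt : IsTestFunctionOn (⊤ : Opens (EuclideanSpace ℝ (Fin 3))) Ξ := isTestFunctionOn_curlPair hg a c
    have hΞd : Differentiable ℝ Ξ := hΞt.contDiff.differentiable (by simp)
    -- every rotate `Ξ_t = R_t Ξ(R_{−t}·)` is a trace-free test field, so the shear hypothesis applies to it
    have horth : ∀ t : ℝ, ∫ w, ⟪U w, NormedSpace.exp (t • B) (fderiv ℝ Ξ (NormedSpace.exp ((-t) • B) w) (B (NormedSpace.exp ((-t) • B) w))) -
        B (NormedSpace.exp (t • B) (Ξ (NormedSpace.exp ((-t) • B) w)))⟫ = 0 := by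
      intro t
      have hs : ContDiff ℝ (⊤ : ℕ∞) (fun w => NormedSpace.exp (t • B) (Ξ (NormedSpace.exp ((-t) • B) w))) :=
        (NormedSpace.exp (t • B)).contDiff.comp (hΞt.contDiff.comp (NormedSpace.exp ((-t) • B)).contDiff)
      have hc : HasCompactSupport (fun w => NormedSpace.exp (t • B) (Ξ (NormedSpace.exp ((-t) • B) w))) :=
        (hasCompactSupport_comp_expSkew hB (-t) hΞt.hasCompactSupport).comp_left (map_zero _)
      have htr : ∀ z, LinearMap.trace ℝ (EuclideanSpace ℝ (Fin 3))
          ((fderiv ℝ (fun w => NormedSpace.exp (t • B) (Ξ (NormedSpace.exp ((-t) • B) w))) z :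
            EuclideanSpace ℝ (Fin 3) →L[ℝ] EuclideanSpace ℝ (Fin 3)) : EuclideanSpace ℝ (Fin 3) →ₗ[ℝ] EuclideanSpace ℝ (Fin 3)) = 0 := by
        intro z
        rw [(hasFDerivAt_rotate B t hΞd z).fderiv, trace_rotate_conj, hΞ]
        exact trace_fderiv_curlPair hg.contDiff a c _
      have h := hshear _ hs hc htr
      simpa only [(hasFDerivAt_rotate B t hΞd _).fderiv, ContinuousLinearMap.comp_apply, TypeIRate.exp_smul_apply_comm] using h
    rw [hsplit Ξ hΞt, integral_inner_rotate_eq_of_shear hB hUl hΞt horth θ, sub_self]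
  -- (3) growth of `D` on balls
  set m : ℝ := 1 - 2 * ρ with hm
  have hm3 : m < 3 := by rw [hm]; linarith
  set Cp : ℝ := max C 0 with hCp
  have hCp0 : 0 ≤ Cp := le_max_right _ _
  have hgrow' : ∀ R : ℝ, 1 ≤ R → ∫⁻ z in ball (0 : EuclideanSpace ℝ (Fin 3)) R, ‖U z‖ₑ ^ 2 ≤ ENNReal.ofReal (Cp * R ^ m) := by
    intro R hR
    refine (hgrow R hR).trans (ENNReal.ofReal_le_ofReal ?_)
    exact mul_le_mul_of_nonneg_right (le_max_left _ _) (Real.rpow_nonneg (by linarith) _)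
  have hDgrowth : ∀ r : ℝ, 1 < r → 0 < r →
      ∫⁻ z in ball (0 : EuclideanSpace ℝ (Fin 3)) r, ‖D z‖ₑ ^ 2 ≤ ENNReal.ofReal (8 * Cp * r ^ m) := by
    intro r hr hr0
    have hr1 : 1 ≤ r := hr.le
    -- pointwise: `‖D‖² ≤ 4(‖U(R_θ ·)‖² + ‖U‖²)`
    have hpt : ∀ z, ‖D z‖ₑ ^ 2 ≤ 4 * (‖U (NormedSpace.exp (θ • B) z)‖ₑ ^ 2 + ‖U z‖ₑ ^ 2) := by
      intro z
      have e1 : ‖NormedSpace.exp ((-θ) • B) (U (NormedSpace.exp (θ • B) z))‖ₑ = ‖U (NormedSpace.exp (θ • B) z)‖ₑ := by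
        rw [← ofReal_norm, ← ofReal_norm, hnorm]
      calc ‖D z‖ₑ ^ 2 ≤ (‖NormedSpace.exp ((-θ) • B) (U (NormedSpace.exp (θ • B) z))‖ₑ + ‖U z‖ₑ) ^ 2 := by
            rw [hD]; gcongr; exact enorm_sub_le
        _ = (‖U (NormedSpace.exp (θ • B) z)‖ₑ + ‖U z‖ₑ) ^ 2 := by rw [e1]
        _ ≤ _ := ENNReal.add_sq_le_four_mul _ _
    -- the rotated ball integral
    have hUm : AEMeasurable (fun z => ‖U (NormedSpace.exp (θ • B) z)‖ₑ ^ 2) (volume.restrict (ball (0 : EuclideanSpace ℝ (Fin 3)) r)) :=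
      (hUrl.aestronglyMeasurable.enorm.pow_const 2).restrict
    have htrans : ∫⁻ z in ball (0 : EuclideanSpace ℝ (Fin 3)) r, ‖U (NormedSpace.exp (θ • B) z)‖ₑ ^ 2 ≤ ENNReal.ofReal (Cp * r ^ m) := by
      rw [setLIntegral_ball_comp_expSkew hB θ (fun y => ‖U y‖ₑ ^ 2) r]
      exact hgrow' r hr1
    calc ∫⁻ z in ball (0 : EuclideanSpace ℝ (Fin 3)) r, ‖D z‖ₑ ^ 2
        ≤ ∫⁻ z in ball (0 : EuclideanSpace ℝ (Fin 3)) r, 4 * (‖U (NormedSpace.exp (θ • B) z)‖ₑ ^ 2 + ‖U z‖ₑ ^ 2) :=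
          lintegral_mono fun z => hpt z
      _ = 4 * ((∫⁻ z in ball (0 : EuclideanSpace ℝ (Fin 3)) r, ‖U (NormedSpace.exp (θ • B) z)‖ₑ ^ 2) +
            ∫⁻ z in ball (0 : EuclideanSpace ℝ (Fin 3)) r, ‖U z‖ₑ ^ 2) := by
          rw [lintegral_const_mul' _ _ (by norm_num), lintegral_add_left' hUm]
      _ ≤ 4 * (ENNReal.ofReal (Cp * r ^ m) + ENNReal.ofReal (Cp * r ^ m)) :=
          mul_le_mul' le_rfl (add_le_add htrans (hgrow' r hr1))
      _ = ENNReal.ofReal (8 * Cp * r ^ m) := by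
          rw [← ENNReal.ofReal_add (by positivity) (by positivity), ← ENNReal.ofReal_ofNat 4,
            ← ENNReal.ofReal_mul (by norm_num)]
          congr 1
          ring
  -- (4) every coordinate of `D` is weakly harmonic with the same growth, hence zero
  have hcoord : ∀ i : Fin 3, (fun x => ⟪D x, EuclideanSpace.single i (1 : ℝ)⟫) =ᵐ[volume] 0 := by
    intro i
    set a : EuclideanSpace ℝ (Fin 3) := EuclideanSpace.single i (1 : ℝ) with ha
    have ha1 : ‖a‖ = 1 := by rw [ha, PiLp.norm_single, norm_one]
    refine ae_eq_zero_of_weaklyHarmonic_of_growth (K := 8 * Cp) (m := m) (r₀ := 1) ?_ ?_ hm3 ?_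
    · have e1 : (fun x => ⟪D x, a⟫) = fun x => (innerSL ℝ a) (D x) := by
        funext x; simp only [innerSL_apply_apply, real_inner_comm]
      rw [e1, ← locallyIntegrableOn_univ]
      exact (innerSL ℝ a).locallyIntegrableOn_comp (locallyIntegrableOn_univ.2 hDl)
    · intro φ hφ hφc
      have hθ' : IsTestFunctionOn (⊤ : Opens (EuclideanSpace ℝ (Fin 3))) φ := ⟨hφ, hφc, by simp⟩
      have := integral_laplacian_mul_inner_eq_zero_of_curlPair hDl hDdiv hDcurl hθ' a
      rw [← this]
      exact integral_congr_ae (Eventually.of_forall fun x => by simp only [mul_comm])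
    · intro r hr hr0
      refine le_trans (lintegral_mono fun x => ?_) (hDgrowth r hr hr0)
      gcongr
      rw [← ofReal_norm, ← ofReal_norm]
      exact ENNReal.ofReal_le_ofReal ((norm_inner_le_norm _ _).trans (by rw [ha1, mul_one]))
  have hall := ae_all_iff.2 hcoord
  filter_upwards [hall] with x hx
  have hDx : D x = 0 := by
    ext i
    have h1 := hx i
    simp only [Pi.zero_apply] at h1
    rw [EuclideanSpace.inner_single_right] at h1
    simpa using h1
  have : NormedSpace.exp ((-θ) • B) (U (NormedSpace.exp (θ • B) x)) - U x = 0 := hDx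
  exact sub_eq_zero.1 this

end Killing

end Summit.NavierStokesRegularity.NavierStokesRegularity.Theorems.PowerGaugeEulerLiouville

end
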